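import Mathlib
import Summits.KontsevichZagierPeriods.Zeta5Search.BrickTwoDigitAll

/-!
# BrickStepF — THEOREM 6 Step F (the cancellation): `Σ_{j ≤ n} q_n(j)·ρ_j^{(s)} ≡ 0 (mod p)` for every `n < p²`,
from (F1) `q_n(j) ≡ q_{n₀}(j₀)`, (E1⁺) `ρ_j ≡ c_{j₀,A}(n₀)·c̃_{j₁,s}(n₁)` and (F4) `Σ_{j₀} q_{n₀}(j₀)c_{j₀,A}(n₀) = 0`
(cell zeta5-irr)

HONEST FRAMING: systematic search; no irrationality claim unless certified. INSTRUMENT lemma of the ζ(5)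
census cell zeta5-irr (HOME `run/shared/lean/pub/zeta5-irr/`; memo `zi-p2/probes/B8/thm6/THEOREM6.md` Step F:
«(F1) `q_n(j) ≡ q_{n_0}(j_0) (mod p)` (polynomial over `ℤ[1/3]`, `p ≥ 5`) … (F4) `Σ_{j=0}^{m}q_m(j)c_{j,A}(m) = 0`
exactly … Summing (D3) over `0 ≤ j ≤ n` with (E1⁺), (F1) and the index decomposition `{0 ≤ j ≤ n} = {j_1 < n_1,
0 ≤ j_0 ≤ p−1} ∪ {j_1 = n_1, j_0 ≤ n_0}`: `Σ_{j=0}^{n}q_n(j)ρ_j^{(s)} ≡ [Σ_{j_0}q_{n_0}(j_0)c_{j_0,A}(n_0)]·[Σ_{j_1}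
cell̃_{j_1}^{(s)}(n_1)] = 0 (mod p)` (F5)»). Nothing here is about ζ(5); no irrationality content; filing moves no rung.
Filed by the engine seat zi-eng (g8): (F1) proved here (`phiMoment_sub_lt`: `3·q_n(j)` is an integer polynomial in
`n, j`); (E1⁺) = `BrickTwoDigitAll.cell_two_digit_all`; (F4) = `BrickTopCoefficient.sum_qBall_mul_cTop` (zi-eng g7).

## The statement

`p ≥ 5` prime, `A` even, `2 ≤ 2B ≤ A`, `n < p²`, `s` arbitrary, `ρ_j^{(s)} = p^{A−s}·c_{j,s}(n)`
(`= p^{A−s}·cell A B 1 n j s`), `q_n(j) = BrickPhiFour.phiMoment A B n j` (LEMMA Φ4's cubic). Then (`stepF`):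

**`v_p(Σ_{j=0}^{n} q_n(j)·p^{A−s}·c_{j,s}(n)) ≥ 1`.**

Ingredients: `three_mul_blockMoment` (`3M_n(c) = 3nc² + 3n²c + n³ − n`), `phiMoment_sub_lt` ((F1) in valuation form),
`sum_mod_div_eq_zero` (the index decomposition: `Σ_{j≤n} f(j%p)·g(j/p) = 0` when `f` vanishes above `n%p` and sums
to `0`), `sum_phiMoment_mul_cTop` ((F4) with `phiMoment`).
-/

namespace Summit.KontsevichZagierPeriods.Zeta5Search.BrickStepF

open Finset Nat WithZero
open Summit.KontsevichZagierPeriods.Zeta5Search.BrickTopCoefficient (cTop sum_qBall_mul_cTop)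
open Summit.KontsevichZagierPeriods.Zeta5Search.BrickPhiFour (blockMoment phiMoment qBall phiMoment_natCast_eq_qBall)
open Summit.KontsevichZagierPeriods.Zeta5Search.BrickLaurent (laurent cell)
open Summit.KontsevichZagierPeriods.Zeta5Search.BrickTopKummer (laurent_valuation_abs)
open Summit.KontsevichZagierPeriods.Zeta5Search.BrickTwoDigitAll (laurent_two_digit_all cTop_one_digit_lt
  padicValuation_centre_le_one)
open Summit.KontsevichZagierPeriods.Zeta5Search.BrickLambda (le_one_of_cong cong_mul)
open Literature.NumberTheory.LFunctions (padicValuation_natCast_le_one)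

noncomputable section

variable {p : ℕ} [Fact p.Prime]

/-! ## (F1): `q_n(j)` depends only on the digits `n mod p`, `j mod p`, modulo `p` -/

omit [Fact p.Prime] in
/-- `3·M_n(c) = 3nc² + 3n²c + n³ − n`. -/
theorem three_mul_blockMoment (n : ℕ) (c : ℤ) :
    3 * blockMoment n c = 3 * n * c ^ 2 + 3 * (n : ℤ) ^ 2 * c + ((n : ℤ) ^ 3 - n) := by
  unfold blockMoment
  induction n with
  | zero => simp
  | succ n ih =>
    rw [Finset.sum_range_succ, mul_add, ih]
    push_cast; ring

omit [Fact p.Prime] in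
/-- `3·q_n(j)` as an explicit integer polynomial in `n` and `j`. -/
theorem three_mul_phiMoment {A B : ℕ} (hAB : 2 * B ≤ A) (n : ℕ) (j : ℤ) :
    3 * phiMoment A B n j =
      ((A : ℤ) - 2 * B) * ((n : ℤ) ^ 3 - n) +
        (B : ℤ) * (3 * n * j ^ 2 + 3 * (n : ℤ) ^ 2 * j + ((n : ℤ) ^ 3 - n)) +
        (B : ℤ) * (3 * n * ((n : ℤ) - j) ^ 2 + 3 * (n : ℤ) ^ 2 * ((n : ℤ) - j) + ((n : ℤ) ^ 3 - n)) -
        (A : ℤ) * (3 * n * (-j) ^ 2 + 3 * (n : ℤ) ^ 2 * (-j) + ((n : ℤ) ^ 3 - n)) := by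
  unfold phiMoment
  have h0 := three_mul_blockMoment n 0
  have h1 := three_mul_blockMoment n j
  have h2 := three_mul_blockMoment n ((n : ℤ) - j)
  have h3 := three_mul_blockMoment n (-j)
  rw [Nat.cast_sub hAB]
  push_cast
  linear_combination (((A : ℤ) - 2 * B)) * h0 + (B : ℤ) * h1 + (B : ℤ) * h2 - (A : ℤ) * h3

/-- **(F1)** `q_n(j) ≡ q_{n mod p}(j mod p) (mod p)` for a prime `p ≠ 3` (in `ZMod p`). -/
theorem phiMoment_cast_eq (hp3 : p ≠ 3) {A B : ℕ} (hAB : 2 * B ≤ A) (n j : ℕ) :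
    ((phiMoment A B n j : ℤ) : ZMod p) = ((phiMoment A B (n % p) ((j % p : ℕ) : ℤ) : ℤ) : ZMod p) := by
  have hp : p.Prime := Fact.out
  have h3 : ((3 : ℤ) : ZMod p) ≠ 0 := by
    rw [show ((3 : ℤ) : ZMod p) = ((3 : ℕ) : ZMod p) by norm_num, ne_eq, ZMod.natCast_eq_zero_iff]
    intro h
    exact hp3 ((Nat.prime_dvd_prime_iff_eq hp Nat.prime_three).1 h)
  apply mul_left_cancel₀ h3
  rw [← Int.cast_mul, ← Int.cast_mul, three_mul_phiMoment hAB, three_mul_phiMoment hAB]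
  push_cast [ZMod.natCast_mod]
  all_goals rfl

/-- (F1) in valuation form: `v_p(q_n(j) − q_{n mod p}(j mod p)) ≥ 1`. -/
theorem phiMoment_sub_lt (hp3 : p ≠ 3) {A B : ℕ} (hAB : 2 * B ≤ A) (n j : ℕ) :
    Rat.padicValuation p ((phiMoment A B n j : ℚ) - (phiMoment A B (n % p) ((j % p : ℕ) : ℤ) : ℚ)) < 1 := by
  rw [← Int.cast_sub, Rat.padicValuation_cast, Int.padicValuation_lt_one_iff,
    ← ZMod.intCast_zmod_eq_zero_iff_dvd, Int.cast_sub, phiMoment_cast_eq hp3 hAB, sub_self]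

/-! ## The index decomposition and (F4) -/

omit [Fact p.Prime] in
/-- `Σ_{j < m·p} F(j) = Σ_{k < m} Σ_{i < p} F(kp + i)`. -/
theorem sum_range_mul (F : ℕ → ℚ) (m : ℕ) :
    ∑ j ∈ range (m * p), F j = ∑ k ∈ range m, ∑ i ∈ range p, F (k * p + i) := by
  induction m with
  | zero => simp
  | succ m ih => rw [Nat.succ_mul, Finset.sum_range_add, ih, Finset.sum_range_succ]

/-- **The index decomposition**: if `f` vanishes above `n mod p` and `Σ_{j₀ ≤ n mod p} f(j₀) = 0`, then for every `g`
`Σ_{j ≤ n} f(j mod p)·g(j / p) = 0`. -/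
theorem sum_mod_div_eq_zero {n : ℕ} {f g : ℕ → ℚ} (hf0 : ∀ i, n % p < i → f i = 0)
    (hsum : ∑ i ∈ range (n % p + 1), f i = 0) : ∑ j ∈ range (n + 1), f (j % p) * g (j / p) = 0 := by
  have hp : p.Prime := Fact.out
  have hp0 : 0 < p := hp.pos
  have hn := Nat.mod_add_div n p
  have hn₀ := Nat.mod_lt n hp0
  -- extend the range to the full block `(n/p + 1)·p`: the added terms vanish
  have hfull : ∑ i ∈ range p, f i = 0 := by
    rw [← Finset.sum_range_add_sum_Ico _ (show n % p + 1 ≤ p by omega), hsum, zero_add]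
    exact Finset.sum_eq_zero fun i hi => hf0 i (by have := (mem_Ico.1 hi).1; omega)
  have hmul : (n / p + 1) * p = p * (n / p) + p := by ring
  have hsub : range (n + 1) ⊆ range ((n / p + 1) * p) := by
    intro x hx; rw [mem_range] at hx ⊢; rw [hmul]; omega
  rw [Finset.sum_subset hsub ?_, sum_range_mul]
  · refine Finset.sum_eq_zero fun k _ => ?_
    rw [show ∑ i ∈ range p, f ((k * p + i) % p) * g ((k * p + i) / p) = (∑ i ∈ range p, f i) * g k from ?_, hfull,
      zero_mul]
    rw [Finset.sum_mul]
    refine Finset.sum_congr rfl fun i hi => ?_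
    have hi' := mem_range.1 hi
    rw [show k * p + i = i + k * p by ring, Nat.add_mul_mod_self_right, Nat.mod_eq_of_lt hi',
      show i + k * p = p * k + i by ring, Nat.mul_add_div hp0, Nat.div_eq_of_lt hi', add_zero]
  · intro j hj hjn
    have hj' := mem_range.1 hj
    have hjn' : n + 1 ≤ j := by simpa using hjn
    have hjdiv : j / p = n / p := by
      refine Nat.div_eq_of_lt_le ?_ hj'
      have := Nat.div_mul_le_self n p; omega
    have hjmod : n % p < j % p := by
      have h1 := Nat.mod_add_div j p
      have h2 : p * (j / p) = p * (n / p) := by rw [hjdiv]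
      omega
    rw [hf0 _ hjmod, zero_mul]

/-- **(F4) with LEMMA Φ4's `phiMoment`**: `Σ_{j₀ ≤ n₀} q_{n₀}(j₀)·c_{j₀,A}(n₀) = 0` (`A` even, `2B ≤ A`). -/
theorem sum_phiMoment_mul_cTop {A B : ℕ} (hA : Even A) (hAB : 2 * B ≤ A) (n₀ : ℕ) :
    ∑ j₀ ∈ range (n₀ + 1), (phiMoment A B n₀ ((j₀ : ℕ) : ℤ) : ℚ) * cTop A B 1 n₀ j₀ = 0 := by
  rw [← sum_qBall_mul_cTop hA B n₀]
  refine Finset.sum_congr rfl fun j₀ hj₀ => ?_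
  rw [phiMoment_natCast_eq_qBall hAB (by have := mem_range.1 hj₀; omega)]

/-! ## Step F -/

/-- **STEP F**: for `p ≥ 5`, `A` even, `2 ≤ 2B ≤ A`, `n < p²` and every `s`:
`v_p(Σ_{j=0}^{n} q_n(j)·p^{A−s}·c_{j,s}(n)) ≥ 1`. -/
theorem stepF (h3 : 3 < p) {A B n : ℕ} (hA : Even A) (hAB : 2 * B ≤ A) (hB : 1 ≤ B) (hn : n < p ^ 2) (s : ℕ) :
    Rat.padicValuation p (∑ j ∈ range (n + 1),
      (phiMoment A B n ((j : ℕ) : ℤ) : ℚ) * ((p : ℚ) ^ (A - s) * cell A B 1 n j s)) < 1 := by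
  have hp : p.Prime := Fact.out
  have hp2 : p ≠ 2 := by omega
  have hp3 : p ≠ 3 := by omega
  have hN : n / p < p := Nat.div_lt_of_lt_mul (by rw [← pow_two]; exact hn)
  -- the model terms `q_{n₀}(j₀)·c_{j₀,A}(n₀)·c̃_{j₁,s}(n₁)` sum to zero exactly
  set f : ℕ → ℚ := fun j₀ => (phiMoment A B (n % p) ((j₀ : ℕ) : ℤ) : ℚ) * cTop A B 1 (n % p) j₀ with hf
  set g : ℕ → ℚ := fun j₁ => cell A B 0 (n / p) j₁ s with hg
  have hzero : ∑ j ∈ range (n + 1), f (j % p) * g (j / p) = 0 := by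
    refine sum_mod_div_eq_zero (fun i hi => ?_) (sum_phiMoment_mul_cTop hA hAB (n % p))
    simp only [hf, cTop, Nat.choose_eq_zero_of_lt hi, Nat.cast_zero, zero_pow (by omega : A ≠ 0), mul_zero, zero_mul]
  -- termwise congruence
  have hterm : ∀ j ∈ range (n + 1), Rat.padicValuation p
      ((phiMoment A B n ((j : ℕ) : ℤ) : ℚ) * ((p : ℚ) ^ (A - s) * cell A B 1 n j s) - f (j % p) * g (j / p)) < 1 := by
    intro j hj
    have hjn : j ≤ n := by have := mem_range.1 hj; omega
    have hJN : j / p ≤ n / p := Nat.div_le_div_right hjn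
    rw [hf, hg]
    simp only
    rw [mul_assoc]
    have hq : Rat.padicValuation p ((phiMoment A B n ((j : ℕ) : ℤ) : ℚ)) ≤ 1 := by
      rw [Rat.padicValuation_cast]; exact Int.padicValuation_le_one _ _
    have hR : Rat.padicValuation p (cTop A B 1 (n % p) (j % p) * cell A B 0 (n / p) (j / p) s) ≤ 1 := by
      rw [map_mul]
      refine mul_le_one' ?_ ?_
      · rw [BrickTwoDigitAll.padicValuation_cTop_one]
        exact mul_le_one' (mul_le_one' (padicValuation_centre_le_one hp2 _ _)
          (pow_le_one' (padicValuation_natCast_le_one _) _))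
          (pow_le_one' (mul_le_one' (padicValuation_natCast_le_one _) (padicValuation_natCast_le_one _)) _)
      · have h := laurent_valuation_abs (p := p) hp2 hAB (L := 0) (ε := 0) (by simpa using hN) hJN (Or.inr rfl) (A - s)
        rwa [Nat.cast_zero, zero_mul, exp_zero] at h
    exact cong_mul (phiMoment_sub_lt hp3 hAB n j) (laurent_two_digit_all hp2 hAB hB hn hjn (A - s)) hq hR
  -- sum up
  have hdiff : Rat.padicValuation p (∑ j ∈ range (n + 1),
      ((phiMoment A B n ((j : ℕ) : ℤ) : ℚ) * ((p : ℚ) ^ (A - s) * cell A B 1 n j s) - f (j % p) * g (j / p))) < 1 :=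
    Valuation.map_sum_lt _ one_ne_zero hterm
  rwa [Finset.sum_sub_distrib, hzero, sub_zero] at hdiff

end

end Summit.KontsevichZagierPeriods.Zeta5Search.BrickStepF
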